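import Summits.QuantumFields.BalabanUV.Beta.EriceRemainderEnclosureHistoryAutonomyOrderWitness
import Summits.QuantumFields.BalabanUV.Beta.EriceRemainderEnclosureHistoryAutonomyThresholdWitness

/-!
# EriceRemainderEnclosureHistoryAutonomyFunctionalShiftLargeContinuityWitness — (E53e) CONTINUITY IN THE FUNCTIONAL FAILS WITHOUT UNIQUENESS: on node U2's bump
# functional `bumpB u = 2 + tent(u₀)` (floor `2`, zeroth moment `20`, box ]0,1]; TWO box solutions `hSlow`, `hFast` from the pin `1`, `T4BetaFlowWellPosed` §7) the
# relative Λ of the two solutions is EXPLICIT — `1∕hSlow(m)² − 1∕hFast(m)² = −1` for every `m ≥ 1`, so `δ_∞(hSlow, hFast) = −1 ≠ 0 = δ_∞(hSlow, hSlow)` — hence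
# along the CONSTANT sequence of functionals `B′_n = bumpB` (uniform convergence with `η = 0`, constant pin `1`) and the ALTERNATING choice of box solutions
# `hSlow, hFast, hSlow, …` the Λ-shifts `0, −1, 0, −1, …` DO NOT CONVERGE: every hypothesis of (E53b) `tendsto_limUnder_of_memFlow_unique` holds except
# UNIQUENESS of the limit problem's solution, and its conclusion fails — the subsequence statement `exists_subseq_tendsto_limUnder` (upper semicontinuity of the
# Λ-set) is the most continuity there is without uniqueness; (E53a)'s continuity along AGEWISE convergence is untouched (the alternating trajectories do not
# converge agewise)

Cell `pub-balaban`, β-function sub-cell, BINDER row D4 «RemainderConst leaves for Bałaban's split» (`HOME/BINDER-OWNERS.md`; owner lineage `b2b-balaban-beta-an4`;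
this file by co-owner #2 lineage `b2b-balaban-beta-d4-p2`, generation 49), β-FLOW TEAM duty (1), FREEZE (0) honoured (def-free; node U2's `bumpB` ∕ `hSlow` ∕ `hFast` ∕
`yFast` ∕ `memFlow_hSlow` ∕ `memFlow_hFast` ∕ `seqBox_hSlow` ∕ `seqBox_hFast` ∕ `hSlow_ne_hFast` ∕ `one_div_sq_one_div_sqrt`, (E48d)'s `zerothMoment_bumpB` ∕
`floor_bumpB`, (E38c)'s `one_div_hSlow_sq` BY NAME, nothing restated).  Companion of (E53b) `…FunctionalShiftLargeContinuityFunctional` (the positive statements); a KERNEL WITNESS, no hypothesis.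

HONEST FRAMING (page 1, verbatim and binding).  *"Discharging BetaPertH makes Bałaban's UV stability UNCONDITIONAL — a real constructive-QFT result; it is
NOT the continuum limit and NOT the Clay problem."*  THIS FILE DISCHARGES NOTHING OF THE KIND.  Arithmetic on node U2's explicit witness (`1 + 2m`, `4 + 2m`);
nothing of Bałaban's (1.22) is asserted or denied — whether his limit functional is in a uniqueness regime is NOT PRINTED ([I] p. 298).  Row D4 class UNCHANGED
(critical-path width 0; instance 0∕1; D4 DISCHARGE NO DATE).  HONEST DEPENDENCY: continuum YM on T⁴ ⇐ BetaPertH ∧ nine spine estimates (0/9 proved); BetaPertH ⇐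
(D1) ∧ (D4) ∧ CAP+tail; G-an2-4 gates asym, D1 and NE2/3/4.

THE POINT (census sense (α); the AUTONOMY row's continuity column — the witness side).  §1: the levels of the two branches are `1 + 2m` and (from scale 1 on)
`4 + 2(m−1)`, so their difference is `−1` from scale `1` on (`disc_hSlow_hFast_succ`) and `δ_∞(hSlow, hFast) = −1` (`tendsto_disc_hSlow_hFast`,
`limUnder_disc_hSlow_hFast`), while `δ_∞(hSlow, hSlow) = 0`.  §2: the alternating sequence of box solutions of ONE problem `(bumpB, 1)` has Λ-shifts against
`hSlow` equal to `0` at even and `−1` at odd indices (`limUnder_disc_alt_even ∕ _odd`), hence NO limit (**`not_tendsto_limUnder_disc_alt`**); §3 records that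
every other binder of (E53b) is met (**`continuity_in_functional_fails_without_uniqueness`**: zeroth moment `20`, floor `2`, box solutions, constant functionals
and pins — and non-convergence).  So the Λ-set `{δ_∞(hSlow, u) : u solves (bumpB, 1)} ⊇ {0, −1}` has at least two points and the Λ-shift, as a function of
«the» solution of the perturbed problem, is not defined continuously across such points: upper semicontinuity is the right statement.  NOT claimed: the full
Λ-set of `(bumpB, 1)`; anything printed.

PRESEARCH.  None needed beyond (E53b)'s (a kernel witness on the tree's own object); recorded: presearch: non-uniqueness witness for flows with memory → in-tree
`T4BetaFlowWellPosed` §7 (node U2) — [folklore].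

WHAT IS PROVED ([folklore]; 0 `def`, 0 sorry).  §1 `invSq_hFast_succ` ((E38c)'s `one_div_hSlow_sq` BY NAME for the slow branch), **`disc_hSlow_hFast_succ`**, **`tendsto_disc_hSlow_hFast`**, `limUnder_disc_hSlow_hFast`,
`limUnder_disc_hSlow_hSlow`.  §2 `limUnder_disc_alt_even`, `limUnder_disc_alt_odd`, **`not_tendsto_limUnder_disc_alt`**.  §3 **`continuity_in_functional_fails_without_uniqueness`**.
-/

noncomputable section
open Filter Topology Finset

namespace Summit.QuantumFields.BalabanUV.Beta.EriceRemainderEnclosureHistoryAutonomyFunctionalShiftLargeContinuityWitness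

open Literature.MathematicalPhysics.QuantumFieldTheory.Balaban1983to89
open Literature.MathematicalPhysics.QuantumFieldTheory.Balaban1983to89.T4BetaStationary
open Literature.MathematicalPhysics.QuantumFieldTheory.Balaban1983to89.T4BetaFlowWellPosed
open Literature.MathematicalPhysics.QuantumFieldTheory.Balaban1983to89.T4BetaFlowWellPosed.Sharpness
open Summit.QuantumFields.BalabanUV.Beta.EriceRemainderEnclosureHistoryAutonomyOrderWitness (zerothMoment_bumpB floor_bumpB)
open Summit.QuantumFields.BalabanUV.Beta.EriceRemainderEnclosureHistoryAutonomyThresholdWitness (one_div_hSlow_sq)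

/-! ## §1 The relative Λ of the two branches is `−1`, explicitly -/

/-- The fast branch's levels from scale one on: `1∕hFast(m+1)² = 4 + 2m`. [folklore] -/
theorem invSq_hFast_succ (m : ℕ) : 1 / hFast (m + 1) ^ 2 = 4 + 2 * (m : ℝ) := by
  unfold hFast; rw [one_div_sq_one_div_sqrt (yFast_pos (m + 1))]; rfl

/-- **THE LEVEL OFFSET OF THE TWO BRANCHES IS `−1` FROM SCALE ONE ON.** [folklore] -/
theorem disc_hSlow_hFast_succ (m : ℕ) : 1 / hSlow (m + 1) ^ 2 - 1 / hFast (m + 1) ^ 2 = -1 := by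
  rw [one_div_hSlow_sq, invSq_hFast_succ]; push_cast; ring

/-- **`δ_∞(hSlow, hFast) = −1`.** [folklore] -/
theorem tendsto_disc_hSlow_hFast : Tendsto (fun m => 1 / hSlow m ^ 2 - 1 / hFast m ^ 2) atTop (𝓝 (-1)) := by
  rw [← tendsto_add_atTop_iff_nat 1]
  exact tendsto_const_nhds.congr fun m => (disc_hSlow_hFast_succ m).symm

/-- … in `limUnder` form. [folklore] -/
theorem limUnder_disc_hSlow_hFast : limUnder atTop (fun m => 1 / hSlow m ^ 2 - 1 / hFast m ^ 2) = -1 :=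
  tendsto_disc_hSlow_hFast.limUnder_eq

/-- `δ_∞(hSlow, hSlow) = 0`. [folklore] -/
theorem limUnder_disc_hSlow_hSlow : limUnder atTop (fun m => 1 / hSlow m ^ 2 - 1 / hSlow m ^ 2) = 0 := by
  simp only [sub_self]; exact tendsto_const_nhds.limUnder_eq

/-! ## §2 The alternating sequence of solutions of ONE problem has no convergent Λ-shifts -/

/-- Along EVEN indices the alternating choice is `hSlow`: Λ-shift `0`. [folklore] -/
theorem limUnder_disc_alt_even (n : ℕ) :
    limUnder atTop (fun m => 1 / hSlow m ^ 2 - 1 / (if (2 * n) % 2 = 0 then hSlow else hFast) m ^ 2) = 0 := by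
  rw [if_pos (by omega)]; exact limUnder_disc_hSlow_hSlow

/-- Along ODD indices it is `hFast`: Λ-shift `−1`. [folklore] -/
theorem limUnder_disc_alt_odd (n : ℕ) :
    limUnder atTop (fun m => 1 / hSlow m ^ 2 - 1 / (if (2 * n + 1) % 2 = 0 then hSlow else hFast) m ^ 2) = -1 := by
  rw [if_neg (by omega)]; exact limUnder_disc_hSlow_hFast

/-- **THE Λ-SHIFTS OF THE ALTERNATING SEQUENCE DO NOT CONVERGE** (`0, −1, 0, −1, …`). [folklore] -/
theorem not_tendsto_limUnder_disc_alt (L : ℝ) :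
    ¬ Tendsto (fun n => limUnder atTop (fun m => 1 / hSlow m ^ 2 - 1 / (if n % 2 = 0 then hSlow else hFast) m ^ 2)) atTop (𝓝 L) := by
  intro hL
  have h2 : Tendsto (fun n : ℕ => 2 * n) atTop atTop := tendsto_atTop_atTop.2 fun b => ⟨b, fun n hn => by omega⟩
  have h21 : Tendsto (fun n : ℕ => 2 * n + 1) atTop atTop := tendsto_atTop_atTop.2 fun b => ⟨b, fun n hn => by omega⟩
  have heven := hL.comp h2
  have hodd := hL.comp h21
  have he : Tendsto (fun n : ℕ => (0 : ℝ)) atTop (𝓝 L) := heven.congr fun n => by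
    show limUnder atTop (fun m => 1 / hSlow m ^ 2 - 1 / (if (2 * n) % 2 = 0 then hSlow else hFast) m ^ 2) = 0
    exact limUnder_disc_alt_even n
  have ho : Tendsto (fun n : ℕ => (-1 : ℝ)) atTop (𝓝 L) := hodd.congr fun n => by
    show limUnder atTop (fun m => 1 / hSlow m ^ 2 - 1 / (if (2 * n + 1) % 2 = 0 then hSlow else hFast) m ^ 2) = -1
    exact limUnder_disc_alt_odd n
  have h0 : L = 0 := tendsto_nhds_unique he tendsto_const_nhds
  have h1 : L = -1 := tendsto_nhds_unique ho tendsto_const_nhds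
  linarith

/-! ## §3 Every binder of (E53b)'s uniqueness statement except uniqueness -/

/-- **CONTINUITY IN THE FUNCTIONAL FAILS WITHOUT UNIQUENESS — THE WITNESS IN (E53b)'s BINDER SHAPES.**  `bumpB` has the zeroth moment `20` and the floor `2` on the
box ]0,1]; the constant sequence of functionals `B′_n = bumpB` converges uniformly to `bumpB` (`η = 0`); the pins are constantly `1 ∈ [1, 1]`; the alternating
sequence consists of box solutions of `(bumpB, 1)`; the reference `hSlow` is a box solution of `(bumpB, 1)`; and yet the Λ-shifts `lim_m (1∕hSlow(m)² − 1∕h′_n(m)²)`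
have NO limit.  The only binder of (E53b) `tendsto_limUnder_of_memFlow_unique` that fails is UNIQUENESS (`hSlow ≠ hFast`). [folklore] -/
theorem continuity_in_functional_fails_without_uniqueness :
    (∀ u u' : ℕ → ℝ, SeqBox 1 u → SeqBox 1 u' → ∀ D : ℝ, (∀ j, |u j - u' j| ≤ D) → |bumpB u - bumpB u'| ≤ 20 * D)
    ∧ (∀ u : ℕ → ℝ, SeqBox 1 u → 2 ≤ bumpB u)
    ∧ (∀ n : ℕ, ∀ u : ℕ → ℝ, SeqBox 1 u → |bumpB u - bumpB u| ≤ (fun _ : ℕ => (0 : ℝ)) n)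
    ∧ SeqBox 1 hSlow ∧ MemFlow bumpB 1 hSlow
    ∧ (∀ n : ℕ, SeqBox 1 (if n % 2 = 0 then hSlow else hFast) ∧ MemFlow bumpB 1 (if n % 2 = 0 then hSlow else hFast))
    ∧ hSlow ≠ hFast
    ∧ ∀ L : ℝ, ¬ Tendsto (fun n => limUnder atTop (fun m => 1 / hSlow m ^ 2 - 1 / (if n % 2 = 0 then hSlow else hFast) m ^ 2)) atTop (𝓝 L) := by
  refine ⟨zerothMoment_bumpB, floor_bumpB, fun n u _ => by simp, seqBox_hSlow, memFlow_hSlow, fun n => ?_, hSlow_ne_hFast,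
    not_tendsto_limUnder_disc_alt⟩
  by_cases h : n % 2 = 0
  · simp only [h, if_true]; exact ⟨seqBox_hSlow, memFlow_hSlow⟩
  · simp only [h, if_false]; exact ⟨seqBox_hFast, memFlow_hFast⟩

end Summit.QuantumFields.BalabanUV.Beta.EriceRemainderEnclosureHistoryAutonomyFunctionalShiftLargeContinuityWitness

end
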